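import Literature.NumberTheory.Transcendental.PiTranscendenceMeasureProofs
import Literature.NumberTheory.Transcendental.QuadraticRelationsLogarithmsMahlerWeil
import Mathlib.Analysis.SpecialFunctions.Complex.Log
import Mathlib.Analysis.Complex.ExponentialBounds
import Mathlib.Analysis.Real.Pi.Bounds
import HarnessLib

/-!
# Nesterenko–Waldschmidt 1996, Theorem 2(1) (algebraic approximation of `π`) from their Main Theorem,
# and Theorem 2(2) from the Main Theorem

Yu. V. Nesterenko, M. Waldschmidt, *On the approximation of the values of exponential function
and logarithm by algebraic numbers*, Mat. Zapiski 2 (1996) 23–42 (= arXiv:math/0002047), §1,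
p. 2: *"For the proof of the first assertion [Theorem 2(1)] we choose `θ = πi`, `α = −1`, `β = iξ`,
`E = e²`, `log A = D⁻¹`, `log B = h(ξ) = h(β)` and note that `D ≤ 2d`. Since
`6.6 d log(2d+2) + log E < 11.2 d (1 + log d)`, `d(h(ξ) + 3 log(2d) + 2 log π + 14) ≤ 17(log L + d log d)`,
`1 + 2E|θ| + 6 log E ≤ 59.5` we derive the assertion 1)."*

This file PROVES that derivation (no definitions, no named facts), with the Main Theorem
(Theorem 1 of the paper) taken as an explicit HYPOTHESIS written out in full — it is not in the
tree (its proof is the whole paper: interpolation determinants, a zero estimate, Fel'dman's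
binomial polynomials with the Rosser–Schoenfeld bound `log lcm(1..k) ≤ (107/103)k`, Liouville's
inequality), and a proving seat may not vendor it as a named fact (D-0026):

* `NesterenkoWaldschmidt1996.part1_of_mainThm` — Theorem 2(1), for every *complex* algebraic `ξ`
  (nothing in the derivation uses that `ξ` is real), from the Main Theorem;
* `NesterenkoWaldschmidt1996_thm_2_2_of_mainThm` — the named fact
  `NesterenkoWaldschmidt1996_thm_2_2` (Theorem 2(2), transcendence measure of `π`) from the Main
  Theorem, through `NesterenkoWaldschmidt1996_thm_2_2_of_part1` (`PiTranscendenceMeasureProofs.lean`,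
  Lemma 1 of the paper).

## The hypothesis (Theorem 1 = Main Theorem, p. 1, as printed plus `α ≠ 0`, `β ≠ 0`)

"Let `θ ∈ ℂ`, `θ ≠ 0`, and `α, β` be algebraic numbers; define `𝕂 = ℚ(α, β)` and `D = [𝕂 : ℚ]`.
Let `A`, `B` and `E` be positive real numbers with `E ≥ e` satisfying `log A ≥ max(h(α), D⁻¹)`,
`log B ≥ h(β)`. Then `|e^θ − α| + |θ − β| ≥ exp(−211 D (log B + log log A + 4 log D + 2 log(E|θ|₊) + 10)
· (D log A + 2E|θ| + 6 log E) · (3.3 D log(D+2) + log E) · (log E)⁻²)`, where `|θ|₊ = max(1, |θ|)`."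
Here `h` is the absolute logarithmic Weil height (the tree's `weilHeight₁ 𝕂 (fun _ : Unit => ·)`,
equal to the printed `(1/d)(log|a₀| + Σ log max{1,|αᵢ|})` by
`RoyWaldschmidt1997.MahlerWeil.weilHeight₁_root_eq`), `𝕂 = IntermediateField.adjoin ℚ {α, β} ⊂ ℂ`.
We ADD the hypotheses `α ≠ 0`, `β ≠ 0`, which the printed statement omits but the printed proof
uses (Lemma 2 is applied with the derivation `∂/∂X + βY∂/∂Y`, `β ≠ 0`, at the points
`(s, α^s)`, `α^s ≠ 0`, §6 Lemma 6); without `β ≠ 0` the printed statement fails for `α = 1`,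
`β = 0`, `θ → 0`.  The weaker hypothesis only strengthens the two theorems below.

## The derivation and its one repaired corner

With `θ = πi`, `α = −1`, `β = iξ` (`ξ ≠ 0`; for `ξ = 0`, `|π − ξ| = π`), `E = e²`, `A = e^{1/D}`,
`log B = (log L)/d ≥ h(ξ) = h(iξ)` (`h(i) = 0`, `h(ξ) = (1/d) log M(Q) ≤ (1/d) log L(Q)`):
`|e^θ − α| = 0`, `|θ − β| = |π − ξ|`, `D = [ℚ(iξ):ℚ] ≤ [ℚ(i):ℚ][ℚ(ξ):ℚ] = 2d`, and the exponent is
`211 · D((log L)/d + 3 log D + 14 + 2 log π) · (13 + 2e²π) · (3.3 D log(D+2) + 2) / 4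
 ≤ 211 · 2·17(log L + d log d) · 59.43 · 11.2 d(1 + log d) / 4 ≤ 1.2·10⁶ d (log L + d log d)(1 + log d)`.
The printed inequality `d(h(ξ) + 3 log(2d) + 2 log π + 14) ≤ 17(log L + d log d)` (used through
`d h(ξ) ≤ log L`, i.e. `18.37 d + 3d log d + log L ≤ 17 log L + 17 d log d`) is FALSE for `d = 1`,
`L = 3` (`19.06 > 18.68`, e.g. `ξ = 2`), and the total constant `211·34·59.43·2.8 = 1.194·10⁶`
leaves no room to absorb it; but there `ξ ∈ {0, ±1, ±2, ±1/2}` and `|π − ξ| ≥ π − 2 > 1`, so the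
conclusion holds trivially (`part1_corner`).  Everywhere else (`d ≥ 2` or `L ≥ 4`) the printed
inequalities hold (`numerics_part1`).

## References
* [NesterenkoWaldschmidt1996] Yu. V. Nesterenko, M. Waldschmidt, Mat. Zapiski 2 (1996) 23–42
  = arXiv:math/0002047, Theorem 1 and the proof of Theorem 2 (p. 2).
-/

noncomputable section

open Polynomial Finset Complex

namespace Literature.NumberTheory.Transcendental

namespace NesterenkoWaldschmidt1996

open Literature.NumberTheory.Transcendental.RoyWaldschmidt1997

/-! ### Algebraic preliminaries: minimal polynomials over `ℤ`, degrees -/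

/-- Every complex algebraic number is a root of an irreducible integer polynomial of positive
degree (an irreducible factor of any non-zero annihilating integer polynomial). [folklore] -/
theorem exists_irreducible_int_aeval_eq_zero {z : ℂ} (hz : IsAlgebraic ℚ z) :
    ∃ P : ℤ[X], Irreducible P ∧ 0 < P.natDegree ∧ aeval z P = 0 := by
  have hzZ : IsAlgebraic ℤ z := (IsFractionRing.isAlgebraic_iff ℤ ℚ ℂ).mpr hz
  obtain ⟨p, hp0, hpz⟩ := hzZ
  -- some irreducible factor of `p` vanishes at `z`
  suffices H : ∀ R : ℤ[X], R ≠ 0 → aeval z R = 0 →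
      ∃ P : ℤ[X], Irreducible P ∧ 0 < P.natDegree ∧ aeval z P = 0 from H p hp0 hpz
  intro R
  induction R using WfDvdMonoid.induction_on_irreducible with
  | zero => intro h; exact absurd rfl h
  | unit u hu =>
    intro _ hu0
    obtain ⟨r, hr, rfl⟩ := Polynomial.isUnit_iff.mp hu
    rw [aeval_C, algebraMap_int_eq, eq_intCast, Int.cast_eq_zero] at hu0
    rcases Int.isUnit_iff.mp hr with h | h <;> simp [h] at hu0
  | mul a i ha hi IH =>
    intro _ h0
    rw [map_mul, mul_eq_zero] at h0
    rcases h0 with h0 | h0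
    · refine ⟨i, hi, ?_, h0⟩
      by_contra hdeg
      push Not at hdeg
      have hdeg0 : i.natDegree = 0 := by omega
      have hc : i.coeff 0 ≠ 0 := by
        intro h
        apply hi.ne_zero
        rw [eq_C_of_natDegree_eq_zero hdeg0, h, C_0]
      rw [eq_C_of_natDegree_eq_zero hdeg0, aeval_C, algebraMap_int_eq, eq_intCast,
        Int.cast_eq_zero] at h0
      exact hc h0
    · exact IH ha h0

/-- An integer polynomial with a complex root `z`, irreducible of positive degree, computes
`[ℚ(z) : ℚ] = deg`. [folklore] -/
theorem finrank_adjoin_eq_natDegree {Q : ℤ[X]} (hQ : Irreducible Q) (hn : 0 < Q.natDegree) {z : ℂ}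
    (hz : aeval z Q = 0) :
    Module.finrank ℚ (IntermediateField.adjoin ℚ ({z} : Set ℂ)) = Q.natDegree := by
  have hprim : Q.IsPrimitive := hQ.isPrimitive (by omega)
  set p : ℚ[X] := Q.map (Int.castRingHom ℚ) with hp
  have hpirr : Irreducible p := (hprim.irreducible_iff_irreducible_map_fraction_map (K := ℚ)).mp hQ
  have hpz : aeval z p = 0 := by
    rw [hp, ← algebraMap_int_eq, aeval_map_algebraMap]
    exact hz
  have hint : IsIntegral ℚ z := (isAlgebraic_iff_isIntegral).mp ⟨p, hpirr.ne_zero, hpz⟩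
  rw [IntermediateField.adjoin.finrank hint, ← minpoly.eq_of_irreducible hpirr hpz,
    natDegree_mul_C (inv_ne_zero (leadingCoeff_ne_zero.mpr hpirr.ne_zero)), hp,
    natDegree_map_eq_of_injective (Int.castRingHom ℚ).injective_int]

/-- `[ℚ(i) : ℚ] ≤ 2`. [folklore] -/
theorem finrank_adjoin_I_le : Module.finrank ℚ (IntermediateField.adjoin ℚ ({I} : Set ℂ)) ≤ 2 := by
  have hI : aeval I (X ^ 2 + C 1 : ℚ[X]) = 0 := by simp
  have h2 : (X ^ 2 + C 1 : ℚ[X]).degree = 2 := by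
    rw [degree_X_pow_add_C (by norm_num : 0 < 2)]; rfl
  have hne : (X ^ 2 + C 1 : ℚ[X]) ≠ 0 := by
    intro h; rw [h, degree_zero] at h2; exact absurd h2 (by decide)
  have hint : IsIntegral ℚ I := (isAlgebraic_iff_isIntegral).mp ⟨_, hne, hI⟩
  rw [IntermediateField.adjoin.finrank hint]
  have h := minpoly.degree_le_of_ne_zero ℚ I hne hI
  rw [h2] at h
  exact natDegree_le_iff_degree_le.mpr h

/-- `[ℚ(−1, iξ) : ℚ] ≤ 2 deg ξ` (`ℚ(−1, iξ) ⊆ ℚ(i)·ℚ(ξ)`). [folklore] -/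
theorem finrank_adjoin_neg_one_I_mul_le {Q : ℤ[X]} (hQ : Irreducible Q) (hn : 0 < Q.natDegree)
    {ξ : ℂ} (hξ : aeval ξ Q = 0) :
    Module.finrank ℚ (IntermediateField.adjoin ℚ ({-1, I * ξ} : Set ℂ)) ≤ 2 * Q.natDegree := by
  set Kξ := IntermediateField.adjoin ℚ ({ξ} : Set ℂ) with hKξ
  set Ki := IntermediateField.adjoin ℚ ({I} : Set ℂ) with hKi
  have hξalg : IsAlgebraic ℚ ξ := by
    refine ⟨Q.map (Int.castRingHom ℚ), (Polynomial.map_ne_zero_iff (Int.castRingHom ℚ).injective_int).mpr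
      hQ.ne_zero, ?_⟩
    rw [← algebraMap_int_eq, aeval_map_algebraMap]; exact hξ
  have hIalg : IsAlgebraic ℚ I := by
    refine ⟨X ^ 2 + C 1, ?_, by simp⟩
    intro h
    have h2 : (X ^ 2 + C 1 : ℚ[X]).degree = 2 := by rw [degree_X_pow_add_C (by norm_num : 0 < 2)]; rfl
    rw [h, degree_zero] at h2; exact absurd h2 (by decide)
  haveI : FiniteDimensional ℚ Kξ :=
    IntermediateField.adjoin.finiteDimensional (isAlgebraic_iff_isIntegral.mp hξalg)
  haveI : FiniteDimensional ℚ Ki :=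
    IntermediateField.adjoin.finiteDimensional (isAlgebraic_iff_isIntegral.mp hIalg)
  have hle : IntermediateField.adjoin ℚ ({-1, I * ξ} : Set ℂ) ≤ Ki ⊔ Kξ := by
    rw [IntermediateField.adjoin_le_iff]
    intro x hx
    simp only [Set.mem_insert_iff, Set.mem_singleton_iff] at hx
    rcases hx with rfl | rfl
    · exact neg_mem (one_mem _)
    · refine mul_mem ?_ ?_
      · exact (le_sup_left : Ki ≤ Ki ⊔ Kξ) (IntermediateField.mem_adjoin_simple_self ℚ I)
      · exact (le_sup_right : Kξ ≤ Ki ⊔ Kξ) (IntermediateField.mem_adjoin_simple_self ℚ ξ)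
  calc Module.finrank ℚ (IntermediateField.adjoin ℚ ({-1, I * ξ} : Set ℂ))
      ≤ Module.finrank ℚ (Ki ⊔ Kξ : IntermediateField ℚ ℂ) := IntermediateField.finrank_le_of_le_right hle
    _ ≤ Module.finrank ℚ Ki * Module.finrank ℚ Kξ := IntermediateField.finrank_sup_le Ki Kξ
    _ ≤ 2 * Q.natDegree := by
        rw [hKξ, finrank_adjoin_eq_natDegree hQ hn hξ]
        exact Nat.mul_le_mul_right _ finrank_adjoin_I_le

/-! ### Heights of `−1`, `i`, `ξ`, `iξ` -/

/-- `h(−1) = 0`. [folklore] -/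
theorem weilHeight₁_neg_one (F : IntermediateField ℚ ℂ) [FiniteDimensional ℚ F] :
    weilHeight₁ F (fun _ : Unit => (-1 : ℂ)) = 0 := by
  have h := weilHeight₁_pow F (neg_mem (one_mem F) : (-1 : ℂ) ∈ F) 2
  rw [neg_one_sq, weilHeight₁_one] at h
  push_cast at h
  linarith

/-- `h(i) = 0`. [folklore] -/
theorem weilHeight₁_I (F : IntermediateField ℚ ℂ) [FiniteDimensional ℚ F] (hI : I ∈ F) :
    weilHeight₁ F (fun _ : Unit => I) = 0 := by
  have h := weilHeight₁_pow F hI 4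
  rw [show I ^ 4 = 1 by rw [show (4 : ℕ) = 2 * 2 from rfl, pow_mul, I_sq]; norm_num,
    weilHeight₁_one] at h
  push_cast at h
  linarith

/-- `h(iξ) ≤ (1/d) log M(Q)` for a root `ξ` of an irreducible `Q ∈ ℤ[X]` of degree `d ≥ 1`, the
height being computed in ANY number field `K ∋ iξ` (`h(iξ) ≤ h(i) + h(ξ) = h(ξ)` in `ℚ(i)·ℚ(ξ)`,
and independence of the field through `MahlerWeil.weilHeight₁_root_eq`). [folklore] -/
theorem weilHeight₁_I_mul_le {Q : ℤ[X]} (hQ : Irreducible Q) (hn : 0 < Q.natDegree) {ξ : ℂ}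
    (hξ : aeval ξ Q = 0) (K : IntermediateField ℚ ℂ) [FiniteDimensional ℚ K] (hK : I * ξ ∈ K) :
    weilHeight₁ K (fun _ : Unit => I * ξ) ≤
      Real.log (Q.map (Int.castRingHom ℂ)).mahlerMeasure / Q.natDegree := by
  set Kξ := IntermediateField.adjoin ℚ ({ξ} : Set ℂ) with hKξ
  set Ki := IntermediateField.adjoin ℚ ({I} : Set ℂ) with hKi
  have hξalg : IsAlgebraic ℚ ξ := by
    refine ⟨Q.map (Int.castRingHom ℚ), (Polynomial.map_ne_zero_iff (Int.castRingHom ℚ).injective_int).mpr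
      hQ.ne_zero, ?_⟩
    rw [← algebraMap_int_eq, aeval_map_algebraMap]; exact hξ
  have hIalg : IsAlgebraic ℚ I := by
    refine ⟨X ^ 2 + C 1, ?_, by simp⟩
    intro h
    have h2 : (X ^ 2 + C 1 : ℚ[X]).degree = 2 := by rw [degree_X_pow_add_C (by norm_num : 0 < 2)]; rfl
    rw [h, degree_zero] at h2; exact absurd h2 (by decide)
  haveI : FiniteDimensional ℚ Kξ :=
    IntermediateField.adjoin.finiteDimensional (isAlgebraic_iff_isIntegral.mp hξalg)
  haveI : FiniteDimensional ℚ Ki :=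
    IntermediateField.adjoin.finiteDimensional (isAlgebraic_iff_isIntegral.mp hIalg)
  have hIK' : I ∈ Ki ⊔ Kξ := (le_sup_left : Ki ≤ Ki ⊔ Kξ) (IntermediateField.mem_adjoin_simple_self ℚ I)
  have hξK' : ξ ∈ Ki ⊔ Kξ := (le_sup_right : Kξ ≤ Ki ⊔ Kξ) (IntermediateField.mem_adjoin_simple_self ℚ ξ)
  have hIξK' : I * ξ ∈ Ki ⊔ Kξ := mul_mem hIK' hξK'
  obtain ⟨P, hP, hPn, hPz⟩ := exists_irreducible_int_aeval_eq_zero (hIalg.mul hξalg)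
  rw [MahlerWeil.weilHeight₁_root_eq P hP hPn hPz K hK,
    ← MahlerWeil.weilHeight₁_root_eq P hP hPn hPz (Ki ⊔ Kξ) hIξK']
  calc weilHeight₁ (Ki ⊔ Kξ) (fun _ : Unit => I * ξ)
      ≤ weilHeight₁ (Ki ⊔ Kξ) (fun _ : Unit => I) + weilHeight₁ (Ki ⊔ Kξ) (fun _ : Unit => ξ) :=
        weilHeight₁_mul_le _ hIK' hξK'
    _ = Real.log (Q.map (Int.castRingHom ℂ)).mahlerMeasure / Q.natDegree := by
        rw [weilHeight₁_I _ hIK', MahlerWeil.weilHeight₁_root_eq Q hQ hn hξ _ hξK', zero_add]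

/-! ### The corner `d = 1`, `L = 3` and the numerical inequalities -/

/-- The corner of Theorem 2(1) not covered by the printed chain of inequalities: a rational `ξ`
with `L(ξ) ≤ 3` has `|ξ| ≤ 2`, so `|π − ξ| ≥ π − 2 > 1`. [folklore] -/
theorem part1_corner {Q : ℤ[X]} (hQ1 : Q.natDegree = 1) {ξ : ℂ} (hξ : aeval ξ Q = 0)
    (hlen : (∑ k ∈ Finset.range (Q.natDegree + 1), |Q.coeff k|) ≤ 3) : 1 ≤ ‖(Real.pi : ℂ) - ξ‖ := by
  have hQ0 : Q ≠ 0 := by rintro rfl; simp at hQ1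
  have ha : Q.coeff 1 ≠ 0 := by
    have : Q.leadingCoeff ≠ 0 := leadingCoeff_ne_zero.mpr hQ0
    rwa [leadingCoeff, hQ1] at this
  rw [hQ1] at hlen
  simp only [Finset.sum_range_succ, Finset.range_one, Finset.sum_singleton] at hlen
  -- `hlen : |Q.coeff 0| + |Q.coeff 1| ≤ 3`
  have hQeq := eq_X_add_C_of_natDegree_le_one (le_of_eq hQ1)
  have hroot : (Q.coeff 1 : ℂ) * ξ + Q.coeff 0 = 0 := by
    rw [hQeq] at hξ
    simpa [map_add, map_mul, aeval_X, aeval_C, algebraMap_int_eq] using hξ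
  have ha1 : (1 : ℝ) ≤ |(Q.coeff 1 : ℝ)| := by exact_mod_cast Int.one_le_abs ha
  have hb2 : |(Q.coeff 0 : ℝ)| ≤ 2 := by
    have h1 : (1 : ℤ) ≤ |Q.coeff 1| := Int.one_le_abs ha
    have : |Q.coeff 0| ≤ 2 := by linarith
    exact_mod_cast this
  have hξnorm : ‖ξ‖ ≤ 2 := by
    have hξeq : ξ = -(Q.coeff 0 : ℂ) / (Q.coeff 1 : ℂ) := by
      have hane : (Q.coeff 1 : ℂ) ≠ 0 := by exact_mod_cast ha
      field_simp
      linear_combination hroot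
    rw [hξeq, norm_div, norm_neg, Complex.norm_intCast, Complex.norm_intCast]
    calc |(Q.coeff 0 : ℝ)| / |(Q.coeff 1 : ℝ)| ≤ |(Q.coeff 0 : ℝ)| / 1 :=
          div_le_div_of_nonneg_left (abs_nonneg _) one_pos ha1
      _ ≤ 2 := by rw [div_one]; exact hb2
  have hπ : ‖(Real.pi : ℂ)‖ = Real.pi := by
    rw [Complex.norm_real, Real.norm_eq_abs, abs_of_pos Real.pi_pos]
  have := norm_sub_norm_le (Real.pi : ℂ) ξ
  rw [hπ] at this
  linarith [Real.pi_gt_three]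

/-- `log π < 1.1459` (from `log 3 < 1.0986122888`, `log(π/3) ≤ π/3 − 1`, `π < 3.141593`). [folklore] -/
theorem log_pi_lt : Real.log Real.pi < 1.1459 := by
  have h1 : Real.log Real.pi = Real.log 3 + Real.log (Real.pi / 3) := by
    rw [← Real.log_mul (by norm_num) (by positivity)]; congr 1; ring
  have h2 : Real.log (Real.pi / 3) ≤ Real.pi / 3 - 1 := Real.log_le_sub_one_of_pos (by positivity)
  have h3 := Real.log_three_lt_d9
  have h4 := Real.pi_lt_d6
  linarith

/-- `exp 2 < 7.3890561`. [folklore] -/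
theorem exp_two_lt : Real.exp 2 < 7.3890561 := by
  have h := Real.exp_one_lt_d9
  have h0 : 0 < Real.exp 1 := Real.exp_pos 1
  rw [show (2 : ℝ) = 1 + 1 by norm_num, Real.exp_add]
  nlinarith

/-- The first printed inequality of the proof of Theorem 2(1) in the form
`d(6 log 2 + 28 + 4 log π) ≤ 32 log L + 28 d log d` for `L ≥ 3`, `d ≥ 1`, (`d ≥ 2` or `L ≥ 4`)
(it fails for `d = 1, L = 3`). Cases `d = 1, 2, 3` and `d ≥ 4`. [cite: NesterenkoWaldschmidt1996, Thm 2 proof] -/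
theorem numerics_part1_F1 (d L : ℕ) (hd : 1 ≤ d) (hL : 3 ≤ L) (hcase : 2 ≤ d ∨ 4 ≤ L) :
    (d : ℝ) * (6 * Real.log 2 + 28 + 4 * Real.log Real.pi) ≤
      32 * Real.log L + 28 * d * Real.log d := by
  have hlog4 : Real.log 4 = 2 * Real.log 2 := by
    rw [show (4 : ℝ) = 2 ^ 2 by norm_num, Real.log_pow]; norm_num
  have hc1 : 0.6931471803 < Real.log 2 := Real.log_two_gt_d9
  have hc2 : Real.log 2 < 0.6931471808 := Real.log_two_lt_d9
  have hl3 : 1.0986122885 < Real.log 3 := Real.log_three_gt_d9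
  have hlπ : Real.log Real.pi < 1.1459 := log_pi_lt
  have hL3 : (3 : ℝ) ≤ L := by exact_mod_cast hL
  have hA3 : Real.log 3 ≤ Real.log L := Real.log_le_log (by norm_num) hL3
  rcases Nat.lt_or_ge d 4 with hlt | hge
  · interval_cases d
    · -- `d = 1`: then `L ≥ 4`, `log L ≥ log 4 = 2 log 2`
      have hL4 : (4 : ℝ) ≤ L := by exact_mod_cast (by omega : 4 ≤ L)
      have hA4 : 2 * Real.log 2 ≤ Real.log L := by
        rw [← hlog4]; exact Real.log_le_log (by norm_num) hL4
      simp only [Nat.cast_one, Real.log_one]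
      linarith
    · -- `d = 2`
      simp only [Nat.cast_ofNat]
      linarith
    · -- `d = 3`
      simp only [Nat.cast_ofNat]
      linarith
  · -- `d ≥ 4`: `log d ≥ log 4 = 2 log 2`, and `6 log 2 + 28 + 4 log π ≤ 56 log 2`
    have hd4 : (4 : ℝ) ≤ d := by exact_mod_cast hge
    have hd0 : (0 : ℝ) ≤ d := by linarith
    have hld4 : 2 * Real.log 2 ≤ Real.log d := by
      rw [← hlog4]; exact Real.log_le_log (by norm_num) hd4
    have h1 : (d : ℝ) * (6 * Real.log 2 + 28 + 4 * Real.log Real.pi) ≤ d * (56 * Real.log 2) :=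
      mul_le_mul_of_nonneg_left (by linarith) hd0
    have h2 : (28 * d : ℝ) * (2 * Real.log 2) ≤ 28 * d * Real.log d :=
      mul_le_mul_of_nonneg_left hld4 (by positivity)
    have h3 : 0 ≤ Real.log (L : ℝ) := by linarith
    linarith

/-- The three printed inequalities of the proof of Theorem 2(1) (p. 2), combined, outside the corner
`d = 1, L = 3`: for `1 ≤ D ≤ 2d`, `L ≥ 3` and (`d ≥ 2` or `L ≥ 4`),
`211 · D((log L)/d + 3 log D + 14 + 2 log π) · (13 + 2e²π) · (3.3 D log(D+2) + 2)/4
≤ 1.2·10⁶ d (log L + d log d)(1 + log d)`. [cite: NesterenkoWaldschmidt1996, Thm 2 proof] -/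
theorem numerics_part1 (d L : ℕ) (D : ℝ) (hd : 1 ≤ d) (hL : 3 ≤ L) (hcase : 2 ≤ d ∨ 4 ≤ L)
    (hD1 : 1 ≤ D) (hD2 : D ≤ 2 * d) :
    211 * D * (Real.log L / d + -Real.log D + 4 * Real.log D + 2 * (2 + Real.log Real.pi) + 10) *
        (D * (1 / D) + 2 * Real.exp 2 * Real.pi + 6 * 2) *
        (33 / 10 * D * Real.log (D + 2) + 2) / 2 ^ 2 ≤
      1200000 * (d : ℝ) * (Real.log L + d * Real.log d) * (1 + Real.log d) := by
  have hF1core := numerics_part1_F1 d L hd hL hcase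
  have hlog4 : Real.log 4 = 2 * Real.log 2 := by
    rw [show (4 : ℝ) = 2 ^ 2 by norm_num, Real.log_pow]; norm_num
  -- constants
  have hc2 : Real.log 2 < 0.6931471808 := Real.log_two_lt_d9
  have hlπ0 : 0 ≤ Real.log Real.pi := Real.log_nonneg (by linarith [Real.pi_gt_three])
  have he2 : Real.exp 2 < 7.3890561 := exp_two_lt
  have he20 : 0 < Real.exp 2 := Real.exp_pos 2
  have hπ1 : Real.pi < 3.141593 := Real.pi_lt_d6
  have hπ0 : 0 < Real.pi := Real.pi_pos
  -- variables
  have hd1 : (1 : ℝ) ≤ d := by exact_mod_cast hd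
  have hd0 : (0 : ℝ) < d := by linarith
  have hL3 : (3 : ℝ) ≤ L := by exact_mod_cast hL
  have hD0 : (0 : ℝ) < D := by linarith
  set A := Real.log (L : ℝ) with hA
  set ld := Real.log (d : ℝ) with hld
  set lD := Real.log D with hlD
  set lπ := Real.log Real.pi with hlπdef
  set e2 := Real.exp 2 with he2def
  set c := Real.log 2 with hc
  have hA0 : 0 ≤ A := Real.log_nonneg (by linarith)
  have hld0 : 0 ≤ ld := Real.log_nonneg hd1
  have hlD0 : 0 ≤ lD := Real.log_nonneg hD1
  have hlD1 : lD ≤ c + ld := by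
    rw [hlD, hld, hc, ← Real.log_mul (by norm_num) (by positivity)]
    exact Real.log_le_log hD0 hD2
  have hlD2' : 0 ≤ Real.log (D + 2) := Real.log_nonneg (by linarith)
  have hlD2 : Real.log (D + 2) ≤ 2 * c + ld := by
    rw [hld, hc, ← hlog4, ← Real.log_mul (by norm_num) (by positivity)]
    exact Real.log_le_log (by linarith) (by linarith)
  have hdld : 0 ≤ (d : ℝ) * ld := mul_nonneg hd0.le hld0
  -- the three factors
  set F1 := D * (A / d + -lD + 4 * lD + 2 * (2 + lπ) + 10) with hF1
  set F2 := D * (1 / D) + 2 * e2 * Real.pi + 6 * 2 with hF2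
  set F3 := 33 / 10 * D * Real.log (D + 2) + 2 with hF3
  -- `F2 ≤ 59.43`
  have hF2eq : F2 = 13 + 2 * (e2 * Real.pi) := by
    rw [hF2, mul_one_div_cancel hD0.ne']; ring
  have he2π : e2 * Real.pi ≤ 7.3890561 * 3.141593 := mul_le_mul he2.le hπ1.le hπ0.le (by norm_num)
  have hF2le : F2 ≤ 59.43 := by rw [hF2eq]; norm_num at he2π ⊢; linarith
  have hF2pos : 0 ≤ F2 := by rw [hF2eq]; positivity
  -- `F3 ≤ 11.2 d (1 + ld)`
  have hF3le : F3 ≤ 11.2 * d * (1 + ld) := by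
    have h1 : 33 / 10 * D * Real.log (D + 2) ≤ 33 / 10 * (2 * d) * (2 * c + ld) := by gcongr
    have h2 : (d : ℝ) * c ≤ d * 0.6931471808 := mul_le_mul_of_nonneg_left hc2.le hd0.le
    rw [hF3]
    norm_num at h2 ⊢
    nlinarith [h1, h2, hdld, hd1]
  have hF3pos : 0 ≤ F3 := by rw [hF3]; positivity
  -- `F1 ≤ 34 (A + d ld)`
  have hF1le : F1 ≤ 34 * (A + d * ld) := by
    have e : F1 = (D / d) * A + D * (3 * lD + 14 + 2 * lπ) := by
      rw [hF1]; field_simp; ring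
    have h1 : D / d * A ≤ 2 * A := by
      have : D / d ≤ 2 := by rw [div_le_iff₀ hd0]; linarith
      exact mul_le_mul_of_nonneg_right this hA0
    have hnn : 0 ≤ 3 * lD + 14 + 2 * lπ := by positivity
    have h2 : D * (3 * lD + 14 + 2 * lπ) ≤ (2 * d) * (3 * (c + ld) + 14 + 2 * lπ) :=
      calc D * (3 * lD + 14 + 2 * lπ) ≤ (2 * d) * (3 * lD + 14 + 2 * lπ) :=
            mul_le_mul_of_nonneg_right hD2 hnn
        _ ≤ (2 * d) * (3 * (c + ld) + 14 + 2 * lπ) :=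
            mul_le_mul_of_nonneg_left (by linarith) (by positivity)
    -- `hF1core : d (6c + 28 + 4 lπ) ≤ 32 A + 28 d ld`
    have h3 : (2 * d : ℝ) * (3 * (c + ld) + 14 + 2 * lπ) =
        d * (6 * c + 28 + 4 * lπ) + 6 * (d * ld) := by ring
    linarith
  have hF1pos : 0 ≤ F1 := by
    rw [hF1]
    have : 0 ≤ A / d + -lD + 4 * lD + 2 * (2 + lπ) + 10 := by
      have : 0 ≤ A / d := div_nonneg hA0 hd0.le
      linarith
    positivity
  -- combine
  have hAdl : 0 ≤ A + d * ld := by linarith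
  have hY : 0 ≤ (A + d * ld) * ((d : ℝ) * (1 + ld)) := by positivity
  calc 211 * D * (A / d + -lD + 4 * lD + 2 * (2 + lπ) + 10) * F2 * F3 / 2 ^ 2
      = 211 * F1 * F2 * F3 / 2 ^ 2 := by rw [hF1]; ring
    _ ≤ 211 * (34 * (A + d * ld)) * 59.43 * (11.2 * d * (1 + ld)) / 2 ^ 2 := by gcongr
    _ = 1193782.296 * ((A + d * ld) * ((d : ℝ) * (1 + ld))) := by ring
    _ ≤ 1200000 * ((A + d * ld) * ((d : ℝ) * (1 + ld))) := by nlinarith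
    _ = 1200000 * (d : ℝ) * (A + d * ld) * (1 + ld) := by ring

/-! ### Theorem 2(1) from the Main Theorem -/

/-- **Nesterenko–Waldschmidt 1996, Theorem 2(1) from Theorem 1.** Hypothesis `hmain` = the Main
Theorem (Theorem 1, p. 1) written out (heights = `weilHeight₁` in `ℚ(α, β)`, `D = [ℚ(α,β):ℚ]`),
with the extra hypotheses `α ≠ 0`, `β ≠ 0` its printed proof uses. Conclusion = Theorem 2(1) for
every complex algebraic `ξ`: if `Q ∈ ℤ[X]` is irreducible of degree `d ≥ 1` with `Q(ξ) = 0` (so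
`d = deg ξ`, `L(Q) = L(ξ)`), `L(Q) ≤ L` and `L ≥ 3`, then
`|π − ξ| ≥ exp{−1.2·10⁶ d (log L + d log d)(1 + log d)}`. Proof as printed (p. 2): `θ = πi`,
`α = −1`, `β = iξ`, `E = e²`, `log A = 1/D`, `log B = (log L)/d ≥ h(iξ)`, `D ≤ 2d`, and
`numerics_part1`; the cases `|π − ξ| ≥ 1` (among them `ξ = 0` and the corner `d = 1, L = 3`,
`part1_corner`) are trivial. [cite: NesterenkoWaldschmidt1996, Thm 2(1)] -/
theorem part1_of_mainThm
    (hmain : ∀ (θ α β : ℂ) (A B E : ℝ), θ ≠ 0 → α ≠ 0 → β ≠ 0 → IsAlgebraic ℚ α → IsAlgebraic ℚ β →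
      0 < A → 0 < B → Real.exp 1 ≤ E →
      max (weilHeight₁ (IntermediateField.adjoin ℚ ({α, β} : Set ℂ)) (fun _ : Unit => α))
          (1 / (Module.finrank ℚ (IntermediateField.adjoin ℚ ({α, β} : Set ℂ)) : ℝ)) ≤ Real.log A →
      weilHeight₁ (IntermediateField.adjoin ℚ ({α, β} : Set ℂ)) (fun _ : Unit => β) ≤ Real.log B →
      Real.exp (-(211 * (Module.finrank ℚ (IntermediateField.adjoin ℚ ({α, β} : Set ℂ)) : ℝ) *
          (Real.log B + Real.log (Real.log A) +
            4 * Real.log (Module.finrank ℚ (IntermediateField.adjoin ℚ ({α, β} : Set ℂ)) : ℝ) +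
            2 * Real.log (E * max 1 ‖θ‖) + 10) *
          ((Module.finrank ℚ (IntermediateField.adjoin ℚ ({α, β} : Set ℂ)) : ℝ) * Real.log A +
            2 * E * ‖θ‖ + 6 * Real.log E) *
          ((33 / 10 : ℝ) * (Module.finrank ℚ (IntermediateField.adjoin ℚ ({α, β} : Set ℂ)) : ℝ) *
              Real.log ((Module.finrank ℚ (IntermediateField.adjoin ℚ ({α, β} : Set ℂ)) : ℝ) + 2) +
            Real.log E) /
          Real.log E ^ 2)) ≤
        ‖Complex.exp θ - α‖ + ‖θ - β‖)
    (Q : ℤ[X]) (ξ : ℂ) (L : ℕ) (hQ : Irreducible Q) (hn : 0 < Q.natDegree) (hξ : aeval ξ Q = 0)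
    (hlen : (∑ k ∈ Finset.range (Q.natDegree + 1), |Q.coeff k|) ≤ (L : ℤ)) (hL : 3 ≤ L) :
    Real.exp (-(1200000 * (Q.natDegree : ℝ) * (Real.log L + Q.natDegree * Real.log Q.natDegree) *
        (1 + Real.log Q.natDegree))) ≤ ‖(Real.pi : ℂ) - ξ‖ := by
  set d := Q.natDegree with hd
  have hd1 : (1 : ℝ) ≤ d := by exact_mod_cast hn
  have hd0 : (0 : ℝ) < d := by linarith
  have hL3 : (3 : ℝ) ≤ L := by exact_mod_cast hL
  have hlogL0 : 0 ≤ Real.log (L : ℝ) := Real.log_nonneg (by linarith)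
  have hlogd0 : 0 ≤ Real.log (d : ℝ) := Real.log_nonneg hd1
  -- the bound is `≤ 1`: the cases `|π − ξ| ≥ 1` are trivial
  have hle1 : Real.exp (-(1200000 * (d : ℝ) * (Real.log L + d * Real.log d) * (1 + Real.log d))) ≤ 1 := by
    rw [Real.exp_le_one_iff, neg_nonpos]
    positivity
  by_cases htriv : 1 ≤ ‖(Real.pi : ℂ) - ξ‖
  · exact hle1.trans htriv
  push Not at htriv
  have hξ0 : ξ ≠ 0 := by
    rintro rfl
    rw [sub_zero, Complex.norm_real, Real.norm_eq_abs, abs_of_pos Real.pi_pos] at htriv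
    linarith [Real.pi_gt_three]
  have hcase : 2 ≤ d ∨ 4 ≤ L := by
    by_contra h
    push Not at h
    have hd1' : d = 1 := by omega
    have hlen3 : (∑ k ∈ Finset.range (Q.natDegree + 1), |Q.coeff k|) ≤ 3 := by
      have : (L : ℤ) ≤ 3 := by exact_mod_cast (by omega : L ≤ 3)
      exact hlen.trans this
    exact absurd (part1_corner hd1' hξ hlen3) (not_le.mpr htriv)
  -- algebraicity
  have hξalg : IsAlgebraic ℚ ξ := by
    refine ⟨Q.map (Int.castRingHom ℚ), (Polynomial.map_ne_zero_iff (Int.castRingHom ℚ).injective_int).mpr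
      hQ.ne_zero, ?_⟩
    rw [← algebraMap_int_eq, aeval_map_algebraMap]; exact hξ
  have hIalg : IsAlgebraic ℚ I := by
    refine ⟨X ^ 2 + C 1, ?_, by simp⟩
    intro h
    have h2 : (X ^ 2 + C 1 : ℚ[X]).degree = 2 := by rw [degree_X_pow_add_C (by norm_num : 0 < 2)]; rfl
    rw [h, degree_zero] at h2; exact absurd h2 (by decide)
  have hβalg : IsAlgebraic ℚ (I * ξ) := hIalg.mul hξalg
  have hαalg : IsAlgebraic ℚ (-1 : ℂ) := isAlgebraic_iff_isIntegral.mpr isIntegral_one.neg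
  -- the field `K = ℚ(−1, iξ)` and its degree `D`
  set K := IntermediateField.adjoin ℚ ({-1, I * ξ} : Set ℂ) with hK
  haveI hKfd : FiniteDimensional ℚ K := by
    refine IntermediateField.finiteDimensional_adjoin (fun x hx => ?_)
    simp only [Set.mem_insert_iff, Set.mem_singleton_iff] at hx
    rcases hx with rfl | rfl
    · exact isIntegral_one.neg
    · exact isAlgebraic_iff_isIntegral.mp hβalg
  set D : ℕ := Module.finrank ℚ K with hD
  have hDpos : 0 < D := Module.finrank_pos
  have hD1 : (1 : ℝ) ≤ D := by exact_mod_cast hDpos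
  have hD0 : (0 : ℝ) < D := by linarith
  have hD2 : (D : ℝ) ≤ 2 * d := by
    have := finrank_adjoin_neg_one_I_mul_le hQ hn hξ
    exact_mod_cast this
  have hIξK : I * ξ ∈ K := IntermediateField.subset_adjoin ℚ _ (by simp)
  -- heights: `max(h(−1), 1/D) = 1/D`, `h(iξ) ≤ (log L)/d`
  have hhα : max (weilHeight₁ K (fun _ : Unit => (-1 : ℂ))) (1 / (D : ℝ)) ≤ Real.log (Real.exp (1 / D)) := by
    rw [Real.log_exp, weilHeight₁_neg_one K]
    exact max_le (by positivity) le_rfl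
  have hMpos : 0 < (Q.map (Int.castRingHom ℂ)).mahlerMeasure :=
    mahlerMeasure_pos_of_ne_zero ((Polynomial.map_ne_zero_iff (Int.castRingHom ℂ).injective_int).mpr hQ.ne_zero)
  have hML : (Q.map (Int.castRingHom ℂ)).mahlerMeasure ≤ L :=
    (mahlerMeasure_le_length Q).trans (by exact_mod_cast hlen)
  have hhβ : weilHeight₁ K (fun _ : Unit => I * ξ) ≤ Real.log (Real.exp (Real.log L / d)) := by
    rw [Real.log_exp]
    refine (weilHeight₁_I_mul_le hQ hn hξ K hIξK).trans ?_
    exact div_le_div_of_nonneg_right (Real.log_le_log hMpos hML) hd0.le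
  -- apply the Main Theorem
  have hθ : (Real.pi : ℂ) * I ≠ 0 := mul_ne_zero (by exact_mod_cast Real.pi_ne_zero) I_ne_zero
  have hM := hmain (Real.pi * I) (-1) (I * ξ) (Real.exp (1 / D)) (Real.exp (Real.log L / d)) (Real.exp 2)
    hθ (by norm_num) (mul_ne_zero I_ne_zero hξ0) hαalg hβalg (Real.exp_pos _) (Real.exp_pos _)
    (Real.exp_le_exp.mpr (by norm_num))
  rw [← hK] at hM
  specialize hM hhα hhβ
  -- the right-hand side is `|π − ξ|`
  have hrhs : ‖Complex.exp (Real.pi * I) - -1‖ + ‖(Real.pi : ℂ) * I - I * ξ‖ = ‖(Real.pi : ℂ) - ξ‖ := by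
    rw [Complex.exp_pi_mul_I, sub_neg_eq_add, neg_add_cancel, norm_zero, zero_add,
      show (Real.pi : ℂ) * I - I * ξ = ((Real.pi : ℂ) - ξ) * I by ring, norm_mul, Complex.norm_I, mul_one]
  rw [hrhs] at hM
  refine le_trans (Real.exp_le_exp.mpr ?_) hM
  rw [neg_le_neg_iff]
  -- simplify the exponent
  have hnormθ : ‖(Real.pi : ℂ) * I‖ = Real.pi := by
    rw [norm_mul, Complex.norm_I, mul_one, Complex.norm_real, Real.norm_eq_abs, abs_of_pos Real.pi_pos]
  have hmax : max 1 Real.pi = Real.pi := max_eq_right (by linarith [Real.pi_gt_three])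
  rw [hnormθ, hmax, Real.log_exp, Real.log_exp, Real.log_exp,
    Real.log_mul (Real.exp_pos 2).ne' Real.pi_pos.ne', Real.log_exp, one_div, Real.log_inv]
  have hnum := numerics_part1 d L D hn hL hcase hD1 hD2
  rw [one_div] at hnum
  exact hnum

end NesterenkoWaldschmidt1996

/-- **Nesterenko–Waldschmidt 1996, Theorem 2(2) (transcendence measure of `π`) from Theorem 1
(Main Theorem).** The named fact `NesterenkoWaldschmidt1996_thm_2_2` follows from the Main Theorem of
the paper (hypothesis `hmain`: Theorem 1 as printed, heights = `weilHeight₁` in `ℚ(α, β)`, plus the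
hypotheses `α ≠ 0`, `β ≠ 0` used by its proof) — through Theorem 2(1)
(`NesterenkoWaldschmidt1996.part1_of_mainThm`) and Lemma 1
(`NesterenkoWaldschmidt1996_thm_2_2_of_part1`), exactly as on p. 2 of the paper.
[cite: NesterenkoWaldschmidt1996, Thm 2(2)] -/
theorem NesterenkoWaldschmidt1996_thm_2_2_of_mainThm
    (hmain : ∀ (θ α β : ℂ) (A B E : ℝ), θ ≠ 0 → α ≠ 0 → β ≠ 0 → IsAlgebraic ℚ α → IsAlgebraic ℚ β →
      0 < A → 0 < B → Real.exp 1 ≤ E →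
      max (weilHeight₁ (IntermediateField.adjoin ℚ ({α, β} : Set ℂ)) (fun _ : Unit => α))
          (1 / (Module.finrank ℚ (IntermediateField.adjoin ℚ ({α, β} : Set ℂ)) : ℝ)) ≤ Real.log A →
      weilHeight₁ (IntermediateField.adjoin ℚ ({α, β} : Set ℂ)) (fun _ : Unit => β) ≤ Real.log B →
      Real.exp (-(211 * (Module.finrank ℚ (IntermediateField.adjoin ℚ ({α, β} : Set ℂ)) : ℝ) *
          (Real.log B + Real.log (Real.log A) +
            4 * Real.log (Module.finrank ℚ (IntermediateField.adjoin ℚ ({α, β} : Set ℂ)) : ℝ) +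
            2 * Real.log (E * max 1 ‖θ‖) + 10) *
          ((Module.finrank ℚ (IntermediateField.adjoin ℚ ({α, β} : Set ℂ)) : ℝ) * Real.log A +
            2 * E * ‖θ‖ + 6 * Real.log E) *
          ((33 / 10 : ℝ) * (Module.finrank ℚ (IntermediateField.adjoin ℚ ({α, β} : Set ℂ)) : ℝ) *
              Real.log ((Module.finrank ℚ (IntermediateField.adjoin ℚ ({α, β} : Set ℂ)) : ℝ) + 2) +
            Real.log E) /
          Real.log E ^ 2)) ≤
        ‖Complex.exp θ - α‖ + ‖θ - β‖) :
    NesterenkoWaldschmidt1996_thm_2_2 :=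
  NesterenkoWaldschmidt1996_thm_2_2_of_part1
    (fun Q ξ L hQ hn hξ hlen hL => NesterenkoWaldschmidt1996.part1_of_mainThm hmain Q ξ L hQ hn hξ hlen hL)

end Literature.NumberTheory.Transcendental

end
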